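import Summits.BirchSwinnertonDyer.BirchSwinnertonDyer.Theorems.PrintCf2SplitBadTwoCyclicInfRes
import HarnessLib

/-!
# Crux `PrintCf2.SplitBadTwoRankOneOfFacts` (stmt-BirchSwinnertonDyer-20368), S3a-quad brick (e2): INFLATION–RESTRICTION ALONG A
# FINITE CYCLIC QUOTIENT, II — finiteness of «invariants ⧸ restrictions» in representative form, and injectivity of `res`
# (generic: any topological group, any discrete module)

Cell `bsd-print-cf2`, width seat `bsd-line-cf2-p1-w5` g6 («width 5»), `--supports stmt-BirchSwinnertonDyer-20368 --as helper`, Theses-free.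
HONEST FRAMING: nothing here closes the crux or a registered stub; no summit statement is proved by this seat; BSD is not proved by any of this.
No definition, no named fact, no `sorry`. Sequel of `…Theorems.PrintCf2SplitBadTwoCyclicInfRes` (file I: the lift `exists_resOfLe_eq_of_witness`).

Setting as in file I: topological group `G`, subgroups `H′ ≤ H ≤ G` with `H′` normal in `G` and relatively open in `H`, `γ ∈ H` generating the
finite cyclic quotient `H/H′` of order `t`, `M` a discrete `G`-module.

* §3 **`exists_finset_sub_mem_range_resOfLe`** — given a finite set `𝒜 ⊆ M` meeting every class of `Ĥ⁰(⟨γ⟩, M^{H′})` (every `H′`-fixed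
  `γ`-fixed `a` is `a₀ + Σ_{i<t} γⁱ·b`, `a₀ ∈ 𝒜`, `b` `H′`-fixed), every set `P` of `γ`-invariant classes of `H¹(H′, M)` contains a finite
  `F`, `#F ≤ #𝒜`, with `P − F ⊆ range res` pointwise: «invariants ⧸ restrictions ↪ Ĥ⁰» in representative form (no quotient objects, so
  that a consumer may intersect `P` with any Selmer condition first);
* §4 `ker_resOfLe_eq_subgroupResKer` (the kernel of `resOfLe` IS the tree's `subgroupResKer` for `H′.subgroupOf H`) and
  **`resOfLe_injective_of_forall_exists_eq_smul_sub`** — if every `H′`-fixed `a` is `γ·b − b` with `b` `H′`-fixed (`H¹(⟨γ⟩, M^{H′}) = 0`),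
  `res : H¹(H, M) → H¹(H′, M)` is INJECTIVE (tree: `ResKernel.finite_subgroupResKer`, continuous orbit maps); `conjH1_resOfLe_eq_of_mem` —
  restrictions are `γ`-invariant.

In the S3a use (`H = pairKer κ₁ κ₂`, `H′ = H ⊓ ker θ`, `θ² = 1`, `M = A_θ` on which `H′` acts trivially and `γ` by `−1`): `γ·b − b = −2b`
is onto (`A_θ` is `2`-divisible) so `res` is injective, and `Ĥ⁰ = A_θ[2]` is finite (`𝒜 := A_θ[2]`), so the invariants modulo restrictions
are finite — the next files of this series add the Selmer conditions and the instantiation.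

presearch: as file I ([corpus: NSW I §6 Prop. 1.6.7]; Serre I §2.6 (b); Greenberg LNM 1716 §3 Lemma 3.1 = tree `ResKernel.finite_subgroupResKer`).
beyond-print theorem: no.

References: [SerreGaloisCohomology1997] I.§2.6 (b); [NeukirchSchmidtWingberg2008] I.§6 Prop. 1.6.7; [GreenbergLNM1716] §3 Lemma 3.1.
-/

noncomputable section

open scoped Classical

set_option linter.dupNamespace false -- D-0017: `…BirchSwinnertonDyer.BirchSwinnertonDyer…` repeats a namespace by design
set_option autoImplicit false

open Literature.NumberTheory.EllipticCurves
open Literature.NumberTheory.EllipticCurves.ResKernel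
open Literature.NumberTheory.EllipticCurves.ZpDescent
open Literature.NumberTheory.GaloisRepresentations

universe u

namespace Summit.BirchSwinnertonDyer.BirchSwinnertonDyer.Theorems.PrintCf2.CyclicInfRes

variable {G : Type u} [Group G] [TopologicalSpace G] [IsTopologicalGroup G]
  {H' H : Subgroup G}
  {M : Type u} [AddCommGroup M] [DistribMulAction G M] [TopologicalSpace M] [DiscreteTopology M]

/-! ## §3. Finiteness of «invariants ⧸ restrictions» in representative form -/

/-- **«Invariants ⧸ restrictions ↪ Ĥ⁰», representative form.** In the setting of `exists_resOfLe_eq_of_witness`, let `𝒜 ⊆ M` be a FINITE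
set such that every `H′`-fixed, `γ`-fixed `a ∈ M` is `a₀ + Σ_{i<t} γⁱ·b` with `a₀ ∈ 𝒜` and `b` `H′`-fixed (a transversal of
`Ĥ⁰(⟨γ⟩, M^{H′}) = (M^{H′})^γ ⧸ N_γ M^{H′}` — or any finite superset). Then every set `P` of `γ`-invariant classes of `H¹(H′, M)` contains a
finite subset `F` with `#F ≤ #𝒜` such that each `x ∈ P` is `x₀ + res y` for some `x₀ ∈ F`, `y ∈ H¹(H, M)`: two classes whose obstructions
share a representative differ by a class with norm obstruction, which lifts (§2). [cite: NeukirchSchmidtWingberg2008, I.§6 Prop. 1.6.7] -/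
theorem exists_finset_sub_mem_range_resOfLe [H'.Normal] (hle : H' ≤ H) {γ : G} (hγ : γ ∈ H) {t : ℕ} (ht : 0 < t)
    (hγt : γ ^ t ∈ H') (hdvd : ∀ d : ℕ, γ ^ d ∈ H' → t ∣ d) (hcover : ∀ g ∈ H, ∃ k < t, ∃ n ∈ H', g = γ ^ k * n)
    (hopen : IsOpen ((H'.subgroupOf H : Subgroup H) : Set H))
    (𝒜 : Finset M)
    (h𝒜 : ∀ a : M, (∀ n ∈ H', n • a = a) → γ • a = a →
      ∃ a₀ b : M, a₀ ∈ 𝒜 ∧ (∀ n ∈ H', n • b = b) ∧ a = a₀ + ∑ i ∈ Finset.range t, γ ^ i • b)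
    (P : Set (subgroupH1 H' M)) (hP : ∀ x ∈ P, conjH1 H' M γ x = x) :
    ∃ F : Finset (subgroupH1 H' M), ↑F ⊆ P ∧ F.card ≤ 𝒜.card ∧
      ∀ x ∈ P, ∃ x₀ ∈ F, ∃ y : subgroupH1 H M, resOfLe M hle y = x - x₀ := by
  classical
  -- choices: representative cocycle, witness, obstruction representative in `𝒜`
  choose φ hφ using fun x : P ↦ oneCocycleClass_surjective (discreteTopRep H' M) (x : subgroupH1 H' M)
  choose m hm using fun x : P ↦ exists_witness_of_conjH1_eq γ (φ x) ((hφ x).symm ▸ hP x x.2)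
  choose a₀ b ha₀ hb hab using fun x : P ↦ h𝒜 _
    (fun n hn ↦ smul_obstruction_eq hγt (φ x) (m x) (hm x) ⟨n, hn⟩) (smul_obstruction_eq' hγt (φ x) (m x) (hm x))
  -- a section of `a₀` over its image
  have himg : ∀ a : {a : M // ∃ x : P, a₀ x = a}, ∃ x : P, a₀ x = a := fun a ↦ a.2
  choose sec hsec using himg
  let R : Finset M := 𝒜.filter fun a ↦ ∃ x : P, a₀ x = a
  let sec' : M → subgroupH1 H' M := fun a ↦
    if h : ∃ x : P, a₀ x = a then ((sec ⟨a, h⟩ : P) : subgroupH1 H' M) else 0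
  have hsec' : ∀ (a : M) (h : ∃ x : P, a₀ x = a), sec' a = ((sec ⟨a, h⟩ : P) : subgroupH1 H' M) :=
    fun a h ↦ dif_pos h
  let F : Finset (subgroupH1 H' M) := R.image sec'
  refine ⟨F, ?_, ?_, ?_⟩
  · intro x hx
    obtain ⟨a, ha, rfl⟩ := Finset.mem_image.mp hx
    have ha' : a ∈ 𝒜 ∧ ∃ x : P, a₀ x = a := Finset.mem_filter.mp ha
    rw [hsec' a ha'.2]
    exact (sec _).2
  · calc F.card ≤ R.card := Finset.card_image_le
      _ ≤ 𝒜.card := Finset.card_filter_le _ _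
  · intro x hx
    let xP : P := ⟨x, hx⟩
    have hex : ∃ x' : P, a₀ x' = a₀ xP := ⟨xP, rfl⟩
    have hR : a₀ xP ∈ R := Finset.mem_filter.mpr ⟨ha₀ xP, hex⟩
    let x₀ : P := sec ⟨a₀ xP, hex⟩
    refine ⟨(x₀ : subgroupH1 H' M), Finset.mem_image.mpr ⟨a₀ xP, hR, hsec' _ hex⟩, ?_⟩
    have hx₀ : a₀ x₀ = a₀ xP := hsec ⟨a₀ xP, hex⟩
    -- the difference cocycle has witness `m x - m x₀` and obstruction `Σ γ^i (b x - b x₀)`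
    have hstar : ∀ n : H', γ • (φ xP - φ x₀).1 (subgroupConj H' γ n) - (φ xP - φ x₀).1 n =
        (n : G) • (m xP - m x₀ + (b xP - b x₀)) - (m xP - m x₀ + (b xP - b x₀)) := by
      intro n
      rw [Submodule.coe_sub, ContinuousMap.sub_apply, ContinuousMap.sub_apply, smul_sub, smul_add, smul_sub, smul_sub,
        hb xP _ n.2, hb x₀ _ n.2]
      have h1 := hm xP n
      have h2 := hm x₀ n
      rw [sub_eq_iff_eq_add] at h1 h2
      rw [h1, h2]
      abel
    have hkey : (φ xP - φ x₀).1 ⟨γ ^ t, hγt⟩ = ∑ i ∈ Finset.range t, γ ^ i • (m xP - m x₀ + (b xP - b x₀)) := by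
      rw [Submodule.coe_sub, ContinuousMap.sub_apply, sum_range_smul_add, sum_range_smul_sub, sum_range_smul_sub]
      have h1 := hab xP
      have h2 := hab x₀
      rw [sub_eq_iff_eq_add] at h1 h2
      rw [h1, h2, hx₀]
      abel
    obtain ⟨y, hy⟩ := exists_resOfLe_eq_of_witness hle hγ ht hγt hdvd hcover hopen (φ xP - φ x₀) _ hstar hkey
    refine ⟨y, ?_⟩
    rw [hy, oneCocycleClass_sub, hφ xP, hφ x₀]

/-! ## §4. The kernel: `res` is injective when `H¹(⟨γ⟩, M^{H′}) = 0` -/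

/-- **`ker (res : H¹(H, M) → H¹(H′, M)) = subgroupResKer M (H′.subgroupOf H)`** (the tree's restriction kernel for the subgroup
`H′.subgroupOf H` of the topological group `↥H`): both maps are induced by the same compatible pair up to `↥(H′.subgroupOf H) ≃ ↥H′`; a class
restricting to zero is represented by a cocycle vanishing on `H′` (`ResKernel.exists_cocycle_of_res_eq_zero`). Generic form of -w5 g3's
`RestrictedSelmerPair.ker_resOfLe_layer_eq_subgroupResKer`. [cite: GreenbergLNM1716, §3 Lemma 3.1 (p. 86)] -/
theorem ker_resOfLe_eq_subgroupResKer (hle : H' ≤ H) (hcont : ∀ m : M, Continuous fun g : G ↦ g • m) :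
    (resOfLe M hle).ker = subgroupResKer M (H'.subgroupOf H) := by
  let N : Subgroup H := H'.subgroupOf H
  have hcont' : ∀ m : M, Continuous fun g : H ↦ g • m := fun m ↦ (hcont m).comp continuous_subtype_val
  apply le_antisymm
  · intro c hc
    let j : N →ₜ* H' :=
      { toFun := fun x ↦ ⟨((x : H) : G), Subgroup.mem_subgroupOf.mp x.2⟩
        map_one' := rfl
        map_mul' := fun _ _ ↦ rfl
        continuous_toFun := (continuous_subtype_val.comp continuous_subtype_val).subtype_mk _ }
    have hcomp : (resH1Hom j (AddMonoidHom.id M) (fun _ _ ↦ rfl)).comp (resOfLe M hle) = resSubgroup N M := by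
      unfold Literature.NumberTheory.EllipticCurves.resOfLe ResKernel.resSubgroup
      rw [resH1Hom_comp]
      exact resH1Hom_congr (ContinuousMonoidHom.ext fun _ ↦ rfl) (AddMonoidHom.ext fun _ ↦ rfl) _ _
    rw [mem_subgroupResKer_iff, ← hcomp, AddMonoidHom.comp_apply, (AddMonoidHom.mem_ker).mp hc, map_zero]
  · intro x hx
    obtain ⟨φ, hφ, hφN⟩ := exists_cocycle_of_res_eq_zero N M hcont' x hx
    rw [AddMonoidHom.mem_ker, ← hφ, resOfLe_oneCocycleClass]
    have h0 : contOneCocycles.pullback (subgroupInclusion hle)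
        (resHomOfEquivariant (subgroupInclusion hle) (AddMonoidHom.id M) (fun _ _ ↦ rfl)) φ = 0 := by
      apply Subtype.ext
      refine ContinuousMap.ext fun τ ↦ ?_
      rw [contOneCocycles.pullback_apply]
      exact hφN ⟨(τ : G), hle τ.2⟩ (Subgroup.mem_subgroupOf.mpr τ.2)
    rw [h0, oneCocycleClass_zero]

/-- **`res : H¹(H, M) → H¹(H′, M)` is INJECTIVE when `(γ − 1)` maps `M^{H′}` onto itself** (and `H = ⋃_k γᵏ H′`, `γ ∈ H`): the kernel is
`H¹(H/H′, M^{H′})`, which for the cyclic quotient generated by `γ` embeds into `M^{H′}/(γ − 1)M^{H′} = 0`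
(`ResKernel.finite_subgroupResKer`, evaluation at `γ`). In the S3a use `γ` acts on `A_θ = M^{H′}` by `−1` and `A_θ` is `2`-divisible.
[cite: GreenbergLNM1716, §3 Lemma 3.1 (p. 86)] [cite: SerreGaloisCohomology1997, I.§2.6 (b)] -/
theorem resOfLe_injective_of_forall_exists_eq_smul_sub [H'.Normal] (hle : H' ≤ H) {γ : G} (hγ : γ ∈ H)
    (hcover : ∀ g ∈ H, ∃ k : ℕ, ∃ n ∈ H', g = γ ^ k * n) (hcont : ∀ m : M, Continuous fun g : G ↦ g • m)
    (hsurj : ∀ a : M, (∀ n ∈ H', n • a = a) → ∃ b : M, (∀ n ∈ H', n • b = b) ∧ a = γ • b - b) :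
    Function.Injective (resOfLe M hle) := by
  let N : Subgroup H := H'.subgroupOf H
  haveI : N.Normal := inferInstance
  let γs : H := ⟨γ, hγ⟩
  have hcont' : ∀ m : M, Continuous fun g : H ↦ g • m := fun m ↦ (hcont m).comp continuous_subtype_val
  have hgen : ∀ U : Subgroup H, IsOpen (U : Set H) → N ≤ U → γs ∈ U → U = ⊤ := by
    intro U _ hNU hγU
    refine (Subgroup.eq_top_iff' U).mpr fun g ↦ ?_
    obtain ⟨k, n, hn, hg⟩ := hcover g g.2
    have hnH : n ∈ H := by
      have : n = (γ ^ k)⁻¹ * g := by rw [hg]; group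
      rw [this]; exact H.mul_mem (H.inv_mem (H.pow_mem hγ k)) g.2
    have e : g = γs ^ k * ⟨n, hnH⟩ := Subtype.ext (by
      simp only [Subgroup.coe_mul, Subgroup.coe_pow]; exact hg)
    rw [e]
    exact U.mul_mem (U.pow_mem hγU k) (hNU (Subgroup.mem_subgroupOf.mpr hn))
  -- the quotient `M^N/(γ − 1)M^N` is trivial
  have hsub : Subsingleton (FixedPoints.addSubgroup N M ⧸ (subOne N M γs).range) := by
    refine ⟨fun a a' ↦ ?_⟩
    induction a using QuotientAddGroup.induction_on with
    | H a =>
    induction a' using QuotientAddGroup.induction_on with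
    | H a' =>
    refine QuotientAddGroup.eq_iff_sub_mem.mpr ?_
    have hfix : ∀ z : FixedPoints.addSubgroup N M, ∀ n ∈ H', n • (z : M) = z := fun z n hn ↦
      z.2 ⟨⟨n, hle hn⟩, Subgroup.mem_subgroupOf.mpr hn⟩
    obtain ⟨b, hb, he⟩ := hsurj ((a - a' : FixedPoints.addSubgroup N M) : M)
      (fun n hn ↦ by rw [AddSubgroup.coe_sub, smul_sub, hfix a n hn, hfix a' n hn])
    refine ⟨⟨b, fun n ↦ hb _ (Subgroup.mem_subgroupOf.mp n.2)⟩, Subtype.ext ?_⟩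
    rw [coe_subOne_apply]
    exact he.symm
  haveI : Finite (FixedPoints.addSubgroup N M ⧸ (subOne N M γs).range) := Finite.of_subsingleton
  obtain ⟨-, hcard⟩ := finite_subgroupResKer N M γs hgen hcont'
  have hcard1 : Nat.card (subgroupResKer M N) ≤ 1 :=
    hcard.trans (Finite.card_le_one_iff_subsingleton.mpr hsub)
  haveI : Finite (subgroupResKer M N) := (finite_subgroupResKer N M γs hgen hcont').1
  have hbot : subgroupResKer M N = ⊥ := by
    refine (AddSubgroup.eq_bot_iff_forall _).mpr fun z hz ↦ ?_
    have hs : Subsingleton (subgroupResKer M N) := (Finite.card_le_one_iff_subsingleton).mp hcard1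
    have := hs.elim ⟨z, hz⟩ ⟨0, (subgroupResKer M N).zero_mem⟩
    exact congrArg Subtype.val this
  refine (injective_iff_map_eq_zero _).mpr fun z hz ↦ ?_
  have hz' : z ∈ (resOfLe M hle).ker := hz
  rw [ker_resOfLe_eq_subgroupResKer hle hcont, hbot, AddSubgroup.mem_bot] at hz'
  exact hz'

/-- **Restrictions are `γ`-invariant** (`H′`, `H` normal in `G`, `γ ∈ H`): `conj_γ (res y) = res (conj_γ y) = res y`, conjugation by an
element of `H` being trivial on `H¹(H, M)` (`conjH1_of_mem_holds`) and commuting with restriction (`resOfLe_comp_conjH1_holds`).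
[cite: SerreLocalFields1979, VII.§5 Prop. 3] -/
theorem conjH1_resOfLe_eq_of_mem [H'.Normal] [H.Normal] (hle : H' ≤ H) {γ : G} (hγ : γ ∈ H) (y : subgroupH1 H M) :
    conjH1 H' M γ (resOfLe M hle y) = resOfLe M hle y := by
  rw [← AddMonoidHom.comp_apply, ← resOfLe_comp_conjH1_holds, AddMonoidHom.comp_apply, conjH1_of_mem_holds H M hγ,
    AddMonoidHom.id_apply]

end Summit.BirchSwinnertonDyer.BirchSwinnertonDyer.Theorems.PrintCf2.CyclicInfRes

end
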